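import Mathlib
import Literature.Analysis.FluidPDE.VectorCalculus
import Literature.Analysis.FluidPDE.LeiZhang2011Proofs

/-!
# Area-law slaving, part 7 — the FAR BARRIER holds for the straight datum's closed-form slip
# (`FilamentSkeletonRss`, child crux `TangentSkeletonNearStraight`, stmt-NavierStokesRegularity-28295, line
# `child_tangent_analytic_strip`; zeroth-order check of the hypothesis `hfar` of parts 3–6)

Parts 3–6 bound the slaved core area under the FAR BARRIER `|τ − c|/2 − c₀√Γ ≤ |w(τ)|` (in filament units), i.e. the slip is
the similarity drift `½⟪y, X′⟫` up to an `O(√Γ)` defect.  At zeroth order (straight datum, waist units `y/√Γ`) the slip is the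
closed-form `W_j` of `StraightDatum`:
  `W_j(s) = ⟪ Σ_{k ≠ j} (γ_k/2π)·(t_k × d_jk(s))/‖d_jk(s)‖² + ½(p_j + s t_j) − α e₃ × (p_j + s t_j), t_j ⟫`,
`d_jk(s)` the component of `p_j + s t_j − p_k` normal to `t_k`.  This file proves the exact algebra behind the barrier:
* `datum_slip_decomp` — `W_j(s) = (s − s₀_j)/2 + [½⟪q_j, t_j⟫ − α⟪e₃ × q_j, t_j⟫ + Σ_{k≠j} partner_k(s)]`, `q_j = p_j + s₀_j t_j`
  (the rotation term sees only the waist point: `⟪e₃ × t_j, t_j⟫ = 0`);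
* `datum_partner_le` — each partner summand is `≤ |γ_k|/(2π ρ)` in modulus: `|⟪t_k × d, t_j⟫| ≤ ‖d‖` and `‖d_jk(s)‖ ≥ ρ` by the
  separation clause (the foot `p_k + ⟪·,t_k⟫ t_k` is a point of line `k`);
* `datum_slip_sub_half_le` — HEADLINE: `|W_j(s) − (s − s₀_j)/2| ≤ Rw/2 + θ⁻¹Rw + N·θ⁻¹/(2πρ)` for ALL `s`, from the datum's
  clauses `‖t_j‖ = 1`, separation `ρ`, `|α|, |γ_k| ≤ θ⁻¹`, waist `‖p_j + s₀_j t_j‖ ≤ Rw`;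
* `datum_slip_far_barrier` — hence `|s − s₀_j|/2 − (Rw/2 + θ⁻¹Rw + Nθ⁻¹/(2πρ)) ≤ |W_j(s)|`: the far barrier of the package with a
  Γ-free defect constant, as the waist scaling `c₀√Γ` of parts 4–6 anticipates (`w ≈ √Γ·W(·/√Γ)`).

HONEST FRAMING: finite-dimensional vector algebra about the straight datum of a HYPOTHETICAL filament skeleton on the NEGATIVE side
of a MODEL route (A1G aside); nothing here bears on Navier–Stokes regularity or blow-up, and no registered stub is closed.
`--supports stmt-NavierStokesRegularity-28295`.
-/

set_option linter.dupNamespace false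

noncomputable section

namespace Summit.NavierStokesRegularity.NavierStokesRegularity.Theorems.AreaLawSlaving

open Set Real Finset
open Literature.Analysis.FluidPDE
open scoped InnerProductSpace

/-! ## §1 Cross-product algebra (`‖a × b‖ ≤ ‖a‖‖b‖` is `Literature.Analysis.FluidPDE.norm_cross_le_norm_mul_norm`; the triple
product `⟪a × b, b⟫ = 0` is proved inline in coordinates, to keep this file out of the route's theses cone) -/

/-- Linearity of `a × ·`: `a × (x + r•y) = a × x + r•(a × y)`. [folklore] -/
theorem cross_add_smul_right (a x y : EuclideanSpace ℝ (Fin 3)) (r : ℝ) :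
    cross a (x + r • y) = cross a x + r • cross a y := by
  rw [← crossCLM_apply, map_add, map_smul, crossCLM_apply, crossCLM_apply]

/-! ## §2 The datum's slip: decomposition and partner bound -/

/-- The partner summand is bounded by `|γ_k|/(2πρ)`: `|(γ/2π)·‖d‖⁻²·⟪t_k × d, t_j⟫| ≤ |γ|/(2π‖d‖) ≤ |γ|/(2πρ)` whenever
`‖d‖ ≥ ρ > 0`, `‖t_k‖ = ‖t_j‖ = 1`. [folklore] -/
theorem datum_partner_le {tk tj d : EuclideanSpace ℝ (Fin 3)} {γ ρ : ℝ} (hρ : 0 < ρ) (hd : ρ ≤ ‖d‖)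
    (htk : ‖tk‖ = 1) (htj : ‖tj‖ = 1) :
    |γ / (2 * Real.pi) * ⟪(‖d‖ ^ 2)⁻¹ • cross tk d, tj⟫_ℝ| ≤ |γ| / (2 * Real.pi * ρ) := by
  have hdpos : 0 < ‖d‖ := hρ.trans_le hd
  rw [real_inner_smul_left, abs_mul, abs_mul]
  have h1 : |⟪cross tk d, tj⟫_ℝ| ≤ ‖d‖ := by
    have h := abs_real_inner_le_norm (cross tk d) tj
    have h' := Literature.Analysis.FluidPDE.norm_cross_le_norm_mul_norm tk d
    rw [htk, one_mul] at h'
    rw [htj, mul_one] at h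
    exact h.trans h'
  have h2 : |(‖d‖ ^ 2)⁻¹| * |⟪cross tk d, tj⟫_ℝ| ≤ 1 / ρ := by
    rw [abs_of_pos (by positivity)]
    calc (‖d‖ ^ 2)⁻¹ * |⟪cross tk d, tj⟫_ℝ| ≤ (‖d‖ ^ 2)⁻¹ * ‖d‖ :=
          mul_le_mul_of_nonneg_left h1 (by positivity)
      _ = 1 / ‖d‖ := by field_simp
      _ ≤ 1 / ρ := one_div_le_one_div_of_le hρ hd
  have hπ : 0 < 2 * Real.pi := by positivity
  rw [abs_div, abs_of_pos hπ]
  calc |γ| / (2 * Real.pi) * (|(‖d‖ ^ 2)⁻¹| * |⟪cross tk d, tj⟫_ℝ|) ≤ |γ| / (2 * Real.pi) * (1 / ρ) :=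
        mul_le_mul_of_nonneg_left h2 (by positivity)
    _ = |γ| / (2 * Real.pi * ρ) := by field_simp

/-- **Decomposition of the datum's slip.**  With `q = p + s₀ t` (`‖t‖ = 1`):
`⟪P + ½(p + s t) − α e₃ × (p + s t), t⟫ = (s − s₀)/2 + (⟪P, t⟫ + ½⟪q, t⟫ − α⟪e₃ × q, t⟫)` for any partner vector `P`. [folklore] -/
theorem datum_slip_decomp (P p t : EuclideanSpace ℝ (Fin 3)) (α s s₀ : ℝ) (ht : ‖t‖ = 1) :
    ⟪P + (1 / 2 : ℝ) • (p + s • t) - α • cross (EuclideanSpace.single 2 1) (p + s • t), t⟫_ℝ =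
      (s - s₀) / 2 + (⟪P, t⟫_ℝ + (1 / 2) * ⟪p + s₀ • t, t⟫_ℝ -
        α * ⟪cross (EuclideanSpace.single 2 1) (p + s₀ • t), t⟫_ℝ) := by
  have hps : p + s • t = (p + s₀ • t) + (s - s₀) • t := by rw [sub_smul]; abel
  have htt : ⟪t, t⟫_ℝ = 1 := by rw [real_inner_self_eq_norm_sq, ht, one_pow]
  have h0 : ⟪cross (EuclideanSpace.single 2 1) t, t⟫_ℝ = 0 := by
    simp [cross, crossProduct, PiLp.inner_apply, Fin.sum_univ_three]
    ring
  rw [hps, cross_add_smul_right]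
  simp only [inner_sub_left, inner_add_left, real_inner_smul_left, h0, htt]
  ring

/-! ## §3 The far barrier for the datum -/

/-- **The datum's slip is the similarity drift up to a bounded defect.**  Under the clauses of `StraightDatum` (unit directions,
`ρ`-separation, `|α|, |γ_k| ≤ θ⁻¹`, waist `‖p_j + s₀_j t_j‖ ≤ Rw`) the closed-form slip satisfies, for every `j` and EVERY `s`,
`|W_j(s) − (s − s₀_j)/2| ≤ Rw/2 + θ⁻¹·Rw + N·θ⁻¹/(2πρ)`. [folklore] -/
theorem datum_slip_sub_half_le {N : ℕ} {ρ θ Rw α : ℝ} {p t : Fin N → EuclideanSpace ℝ (Fin 3)} {γ : Fin N → ℝ}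
    {s₀ : Fin N → ℝ} (hρ : 0 < ρ) (hθ : 0 < θ) (ht : ∀ j, ‖t j‖ = 1)
    (hsep : ∀ j k, j ≠ k → ∀ τ σ : ℝ, ρ ≤ ‖(p j + τ • t j) - (p k + σ • t k)‖)
    (hα : |α| ≤ θ⁻¹) (hγ : ∀ j, |γ j| ≤ θ⁻¹) (hwaist : ∀ j, ‖p j + s₀ j • t j‖ ≤ Rw)
    (W : Fin N → ℝ → ℝ)
    (hW : ∀ j s, W j s = ⟪(∑ k ∈ Finset.univ.erase j, (γ k / (2 * Real.pi)) •
      ((‖(p j + s • t j - p k) - ⟪p j + s • t j - p k, t k⟫_ℝ • t k‖ ^ 2)⁻¹ •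
        cross (t k) ((p j + s • t j - p k) - ⟪p j + s • t j - p k, t k⟫_ℝ • t k))) +
      (1 / 2 : ℝ) • (p j + s • t j) - α • cross (EuclideanSpace.single 2 1) (p j + s • t j), t j⟫_ℝ)
    (j : Fin N) (s : ℝ) :
    |W j s - (s - s₀ j) / 2| ≤ Rw / 2 + θ⁻¹ * Rw + N * θ⁻¹ / (2 * Real.pi * ρ) := by
  rw [hW j s, datum_slip_decomp _ _ _ _ _ (s₀ j) (ht j)]
  set q : EuclideanSpace ℝ (Fin 3) := p j + s₀ j • t j with hq
  have hqn : ‖q‖ ≤ Rw := hwaist j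
  -- the partner sum
  rw [sum_inner]
  have hpart : ∀ k ∈ Finset.univ.erase j,
      |⟪(γ k / (2 * Real.pi)) • ((‖(p j + s • t j - p k) - ⟪p j + s • t j - p k, t k⟫_ℝ • t k‖ ^ 2)⁻¹ •
        cross (t k) ((p j + s • t j - p k) - ⟪p j + s • t j - p k, t k⟫_ℝ • t k)), t j⟫_ℝ| ≤
        θ⁻¹ / (2 * Real.pi * ρ) := by
    intro k hk
    have hkj : j ≠ k := fun h => (Finset.ne_of_mem_erase hk) h.symm
    set d : EuclideanSpace ℝ (Fin 3) := (p j + s • t j - p k) - ⟪p j + s • t j - p k, t k⟫_ℝ • t k with hd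
    have hdρ : ρ ≤ ‖d‖ := by
      have h := hsep j k hkj s (⟪p j + s • t j - p k, t k⟫_ℝ)
      have : (p j + s • t j) - (p k + ⟪p j + s • t j - p k, t k⟫_ℝ • t k) = d := by rw [hd]; abel
      rwa [this] at h
    rw [real_inner_smul_left]
    have h := datum_partner_le (γ := γ k) (tk := t k) (tj := t j) hρ hdρ (ht k) (ht j)
    have hγk : |γ k| / (2 * Real.pi * ρ) ≤ θ⁻¹ / (2 * Real.pi * ρ) :=
      div_le_div_of_nonneg_right (hγ k) (by positivity)
    exact h.trans hγk
  have hsum : |∑ k ∈ Finset.univ.erase j,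
      ⟪(γ k / (2 * Real.pi)) • ((‖(p j + s • t j - p k) - ⟪p j + s • t j - p k, t k⟫_ℝ • t k‖ ^ 2)⁻¹ •
        cross (t k) ((p j + s • t j - p k) - ⟪p j + s • t j - p k, t k⟫_ℝ • t k)), t j⟫_ℝ| ≤
        N * θ⁻¹ / (2 * Real.pi * ρ) := by
    refine (Finset.abs_sum_le_sum_abs _ _).trans ?_
    refine (Finset.sum_le_card_nsmul _ _ _ hpart).trans ?_
    rw [Finset.card_erase_of_mem (Finset.mem_univ j), Finset.card_univ, Fintype.card_fin, nsmul_eq_mul]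
    have hc : 0 ≤ θ⁻¹ / (2 * Real.pi * ρ) := by positivity
    have hN : ((N - 1 : ℕ) : ℝ) ≤ N := by exact_mod_cast Nat.sub_le N 1
    calc ((N - 1 : ℕ) : ℝ) * (θ⁻¹ / (2 * Real.pi * ρ)) ≤ N * (θ⁻¹ / (2 * Real.pi * ρ)) :=
          mul_le_mul_of_nonneg_right hN hc
      _ = N * θ⁻¹ / (2 * Real.pi * ρ) := by ring
  -- the waist terms
  have hqt : |(1 / 2) * ⟪q, t j⟫_ℝ| ≤ Rw / 2 := by
    rw [abs_mul, abs_of_pos (by norm_num : (0:ℝ) < 1 / 2)]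
    have h := abs_real_inner_le_norm q (t j)
    rw [ht j, mul_one] at h
    linarith
  have hrot : |α * ⟪cross (EuclideanSpace.single 2 1) q, t j⟫_ℝ| ≤ θ⁻¹ * Rw := by
    rw [abs_mul]
    have h := abs_real_inner_le_norm (cross (EuclideanSpace.single 2 1) q) (t j)
    have h' := Literature.Analysis.FluidPDE.norm_cross_le_norm_mul_norm (EuclideanSpace.single (2 : Fin 3) (1:ℝ)) q
    have he : ‖(EuclideanSpace.single (2 : Fin 3) (1:ℝ))‖ = 1 := by simp
    rw [he, one_mul] at h'
    rw [ht j, mul_one] at h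
    have h3 : |⟪cross (EuclideanSpace.single 2 1) q, t j⟫_ℝ| ≤ Rw := h.trans (h'.trans hqn)
    exact mul_le_mul hα h3 (abs_nonneg _) (by positivity)
  -- assembly
  have e : (s - s₀ j) / 2 + (∑ k ∈ Finset.univ.erase j,
      ⟪(γ k / (2 * Real.pi)) • ((‖(p j + s • t j - p k) - ⟪p j + s • t j - p k, t k⟫_ℝ • t k‖ ^ 2)⁻¹ •
        cross (t k) ((p j + s • t j - p k) - ⟪p j + s • t j - p k, t k⟫_ℝ • t k)), t j⟫_ℝ +
      (1 / 2) * ⟪q, t j⟫_ℝ - α * ⟪cross (EuclideanSpace.single 2 1) q, t j⟫_ℝ) - (s - s₀ j) / 2 =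
      (∑ k ∈ Finset.univ.erase j,
      ⟪(γ k / (2 * Real.pi)) • ((‖(p j + s • t j - p k) - ⟪p j + s • t j - p k, t k⟫_ℝ • t k‖ ^ 2)⁻¹ •
        cross (t k) ((p j + s • t j - p k) - ⟪p j + s • t j - p k, t k⟫_ℝ • t k)), t j⟫_ℝ) +
      (1 / 2) * ⟪q, t j⟫_ℝ + -(α * ⟪cross (EuclideanSpace.single 2 1) q, t j⟫_ℝ) := by ring
  rw [e]
  refine (abs_add_le _ _).trans ?_
  refine (add_le_add (abs_add_le _ _) le_rfl).trans ?_
  rw [abs_neg]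
  linarith

/-- **Far barrier for the datum.**  Consequently `|s − s₀_j|/2 − (Rw/2 + θ⁻¹Rw + Nθ⁻¹/(2πρ)) ≤ |W_j(s)|` for every `s`
— the hypothesis `hfar` of parts 3–6 at zeroth order, with a Γ-free defect. [folklore] -/
theorem datum_slip_far_barrier {N : ℕ} {ρ θ Rw α : ℝ} {p t : Fin N → EuclideanSpace ℝ (Fin 3)} {γ : Fin N → ℝ}
    {s₀ : Fin N → ℝ} (hρ : 0 < ρ) (hθ : 0 < θ) (ht : ∀ j, ‖t j‖ = 1)
    (hsep : ∀ j k, j ≠ k → ∀ τ σ : ℝ, ρ ≤ ‖(p j + τ • t j) - (p k + σ • t k)‖)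
    (hα : |α| ≤ θ⁻¹) (hγ : ∀ j, |γ j| ≤ θ⁻¹) (hwaist : ∀ j, ‖p j + s₀ j • t j‖ ≤ Rw)
    (W : Fin N → ℝ → ℝ)
    (hW : ∀ j s, W j s = ⟪(∑ k ∈ Finset.univ.erase j, (γ k / (2 * Real.pi)) •
      ((‖(p j + s • t j - p k) - ⟪p j + s • t j - p k, t k⟫_ℝ • t k‖ ^ 2)⁻¹ •
        cross (t k) ((p j + s • t j - p k) - ⟪p j + s • t j - p k, t k⟫_ℝ • t k))) +
      (1 / 2 : ℝ) • (p j + s • t j) - α • cross (EuclideanSpace.single 2 1) (p j + s • t j), t j⟫_ℝ)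
    (j : Fin N) (s : ℝ) :
    |s - s₀ j| / 2 - (Rw / 2 + θ⁻¹ * Rw + N * θ⁻¹ / (2 * Real.pi * ρ)) ≤ |W j s| := by
  have h := datum_slip_sub_half_le hρ hθ ht hsep hα hγ hwaist W hW j s
  have h1 : |(s - s₀ j) / 2| - |W j s| ≤ |W j s - (s - s₀ j) / 2| := by
    rw [abs_sub_comm]; exact abs_sub_abs_le_abs_sub _ _
  rw [abs_div, abs_of_pos (by norm_num : (0:ℝ) < 2)] at h1
  linarith

end Summit.NavierStokesRegularity.NavierStokesRegularity.Theorems.AreaLawSlaving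

end
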